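import Mathlib.RingTheory.GradedAlgebra.Homogeneous.Ideal
import Mathlib.RingTheory.Ideal.Colon
import Mathlib.Algebra.Module.Torsion.Basic
import Mathlib.RingTheory.Ideal.Quotient.Operations
import HarnessLib

/-!
# Colon ideals and saturations of homogeneous ideals are homogeneous

Let `A = ⊕ᵢ 𝒜 i` be a graded ring (degrees in a cancellative additive monoid, e.g. `ℕ`) and
`I ⊆ A` a homogeneous ideal. For a HOMOGENEOUS element `c ∈ 𝒜 j`:

* `Ideal.IsHomogeneous.colon_singleton_of_mem` — the colon ideal `(I : c) = {x | x c ∈ I}` is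
  homogeneous (the `i`-th component of `x c` is `xᵢ c`);
* `Ideal.IsHomogeneous.colon_of_forall_mem` — `(I : S)` is homogeneous for a set `S` of
  homogeneous elements;
* `Ideal.IsHomogeneous.saturation_singleton_of_mem` — the saturation
  `(I : c^∞) = ⋃ₙ (I : cⁿ)` is homogeneous;
* `Ideal.mk_mem_torsionBy_iff_mem_colon`, `Ideal.mk_mem_iSup_torsionBy_pow_iff` — in `A ⧸ I`
  the `c`-torsion (resp. `c^∞`-torsion) is the image of `(I : c)` (resp. `(I : c^∞)`), so the
  `c^∞`-torsion-free quotient of `A ⧸ I` is `A ⧸ (I : c^∞)`, again a quotient by a homogeneous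
  ideal.

Standard (Bruns–Herzog §1.5: sums, products, intersections, colons and radicals of graded ideals
are graded; Hartshorne II Ex. 5.10 (a) for the saturation by the irrelevant ideal). Mathlib has
`Ideal.IsHomogeneous.{inf,sup,iSup,iInf,mul,radical}` but not the colon. Use in this tree: the
strict transform of `Proj (R'[x]/J)` along a blowing up with exceptional equation `c ∈ R'`
(degree `0`) is `Proj (R'[x]/(J : c^∞))` (cell memo `lit/res-lit-4/gen21/FLATTENING-ROADMAP.md`
§5.5).

## References

* [BrunsHerzog1998] W. Bruns, J. Herzog, *Cohen–Macaulay rings*, rev. ed. (1998), §1.5 (graded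
  rings and modules: operations on graded ideals).
* [Hartshorne1977] R. Hartshorne, *Algebraic Geometry* (1977), II, Ex. 5.10 (a) (saturation of a
  homogeneous ideal).
-/

open DirectSum

namespace Literature.RingTheory.GradedAlgebra

variable {ι σ A : Type*} [CommRing A] [SetLike σ A] [AddSubmonoidClass σ A]
  [DecidableEq ι] [AddCancelCommMonoid ι] (𝒜 : ι → σ) [GradedRing 𝒜]

/-- **`(I : c)` is homogeneous for `I` homogeneous and `c` homogeneous.** The `i`-th homogeneous
component of `x c` is `xᵢ c` (`c ∈ 𝒜 j`), so `x c ∈ I` forces `xᵢ c ∈ I`.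
[cite: BrunsHerzog1998, §1.5 (operations on graded ideals)] -/
theorem Ideal.IsHomogeneous.colon_singleton_of_mem {I : Ideal A} (hI : I.IsHomogeneous 𝒜)
    {c : A} {j : ι} (hc : c ∈ 𝒜 j) : (I.colon {c}).IsHomogeneous 𝒜 := by
  intro i x hx
  rw [Submodule.mem_colon_singleton, smul_eq_mul] at hx ⊢
  have h := hI (i + j) hx
  rwa [coe_decompose_mul_add_of_right_mem 𝒜 hc] at h

/-- **`(I : S)` is homogeneous for a set `S` of homogeneous elements.**
[cite: BrunsHerzog1998, §1.5 (operations on graded ideals)] -/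
theorem Ideal.IsHomogeneous.colon_of_forall_mem {I : Ideal A} (hI : I.IsHomogeneous 𝒜)
    {S : Set A} (hS : ∀ c ∈ S, ∃ j, c ∈ 𝒜 j) : (I.colon S).IsHomogeneous 𝒜 := by
  have hcol : I.colon S = ⨅ c : S, I.colon {(c : A)} := by
    ext x
    simp only [Submodule.mem_colon, Submodule.mem_iInf, Set.mem_singleton_iff, forall_eq,
      Subtype.forall]
  rw [hcol]
  exact Ideal.IsHomogeneous.iInf fun c => by
    obtain ⟨j, hj⟩ := hS c c.2
    exact Ideal.IsHomogeneous.colon_singleton_of_mem 𝒜 hI hj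

/-- **The saturation `(I : c^∞) = ⨆ₙ (I : cⁿ)` is homogeneous** (`I` homogeneous, `c ∈ 𝒜 j`).
[cite: Hartshorne1977, II Ex. 5.10 (a)] [cite: BrunsHerzog1998, §1.5] -/
theorem Ideal.IsHomogeneous.saturation_singleton_of_mem {I : Ideal A} (hI : I.IsHomogeneous 𝒜)
    {c : A} {j : ι} (hc : c ∈ 𝒜 j) : (⨆ n : ℕ, I.colon {c ^ n}).IsHomogeneous 𝒜 :=
  Ideal.IsHomogeneous.iSup fun n =>
    Ideal.IsHomogeneous.colon_singleton_of_mem 𝒜 hI (SetLike.pow_mem_graded n hc)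

omit [SetLike σ A] [AddSubmonoidClass σ A] [DecidableEq ι] [AddCancelCommMonoid ι]
  [GradedRing 𝒜] in
/-- In `A ⧸ I`, the class of `x` is `c`-torsion iff `x ∈ (I : c)` — immediate from the definition
of the ideal quotient `(I : c) = {x | x c ∈ I}` (Atiyah–Macdonald, Ch. 1, "ideal quotient";
`(0 : x) = Ann x`). [cite: AtiyahMacdonald1969, Ch. 1, ideal quotients (p. 8) and Ex. 1.12] -/
theorem Ideal.mk_mem_torsionBy_iff_mem_colon (I : Ideal A) (c x : A) :
    Ideal.Quotient.mk I x ∈ Submodule.torsionBy A (A ⧸ I) c ↔ x ∈ I.colon {c} := by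
  rw [Submodule.mem_torsionBy_iff, Submodule.mem_colon_singleton, smul_eq_mul,
    Algebra.smul_def c (Ideal.Quotient.mk I x), Ideal.Quotient.algebraMap_eq, ← map_mul,
    Ideal.Quotient.eq_zero_iff_mem, mul_comm]

omit [SetLike σ A] [AddSubmonoidClass σ A] [DecidableEq ι] [AddCancelCommMonoid ι]
  [GradedRing 𝒜] in
/-- In `A ⧸ I`, the class of `x` is `c^∞`-torsion iff `x ∈ (I : c^∞) = ⨆ₙ (I : cⁿ)` (the
saturation of `I` with respect to `c`; Atiyah–Macdonald Ch. 1 ideal quotients, Hartshorne II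
Ex. 5.10 (a) for the notion of saturation). [cite: AtiyahMacdonald1969, Ch. 1, ideal quotients (p. 8)]
[cite: Hartshorne1977, II Ex. 5.10 (a)] -/
theorem Ideal.mk_mem_iSup_torsionBy_pow_iff (I : Ideal A) (c x : A) :
    Ideal.Quotient.mk I x ∈ (⨆ n : ℕ, Submodule.torsionBy A (A ⧸ I) (c ^ n)) ↔
      x ∈ ⨆ n : ℕ, I.colon {c ^ n} := by
  have hdirT : Directed (· ≤ ·) fun n : ℕ => Submodule.torsionBy A (A ⧸ I) (c ^ n) := by
    refine Monotone.directed_le fun m n hmn => ?_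
    intro y hy
    rw [Submodule.mem_torsionBy_iff] at hy ⊢
    rw [← Nat.add_sub_cancel' hmn, pow_add, mul_comm, mul_smul, hy, smul_zero]
  have hdirC : Directed (· ≤ ·) fun n : ℕ => I.colon {c ^ n} := by
    refine Monotone.directed_le fun m n hmn => ?_
    intro y hy
    rw [Submodule.mem_colon_singleton, smul_eq_mul] at hy ⊢
    rw [← Nat.add_sub_cancel' hmn, pow_add, ← mul_assoc]
    exact I.mul_mem_right _ hy
  rw [Submodule.mem_iSup_of_directed _ hdirT, Submodule.mem_iSup_of_directed _ hdirC]
  exact exists_congr fun n => Ideal.mk_mem_torsionBy_iff_mem_colon I (c ^ n) x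

end Literature.RingTheory.GradedAlgebra
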